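import Summits.ResolutionOfSingularities.ResolutionOfSingularities.Theorems.TowerDictionaryHoldsA
import Summits.ResolutionOfSingularities.ResolutionOfSingularities.Theorems.StalkThread2
import Summits.ResolutionOfSingularities.ResolutionOfSingularities.Theorems.KResidue
import Summits.ResolutionOfSingularities.ResolutionOfSingularities.Theorems.LinDisjoint
import HarnessLib

/-!
# «TowerDictionaryHolds», slice B (of 2) — `TightDefectClasses.TowerDictionary`, discharged

(lens-5 g39, node g39o; critic ROW 232 Q2a / ROW 238 window, door (M-Dict); letters 238a f1–f7 / 238b–k.)

`towerDictionary_holds : TowerDictionary` — VERBATIM, zero extra binders — via the instance-free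
`exists_forcedWalk_of_rooted` (any algebraically closed `K ⊇ k` of characteristic `p`, separable over `k`, and any
injective `K`-frame `Θ : K[Z,u₁,u₂,u₃] → L`; instantiated at `K := AlgebraicClosure k`, `L := Frac K[Z,u]`).

The dictionary (architecture S′; slice A = `Theorems/TowerDictionaryHoldsA.lean`: `rho`, `exists_prime_symb_of_frame`):
* the `k`-side stages `B_i = ψ_i(𝒪_{X_i,x_i}) ⊆ L` [Theorems/StalkThread2: `exists_iStage_zero`, `ichain`, `inextCert`,
  `inextStage_fact`, `inextStage_dominates`, `inextStage_comp`], read as `k`-subalgebras; their residue fields are algebraic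
  over `k` [Theorems/KResidue]; `μ_i : B_i ⊗_k K → L` is injective [Theorems/LinDisjoint, KThread]; the thread of `K`-rational
  points `𝔴_i` [Theorems/KStage §3 ← KChain]; the `K`-side stages `B̃_i = KCarrier.carrier μ_i 𝔴_i` with all their side
  conditions [Theorems/KStage §1–§2 ← KCarrier, KFibre, KThread];
* the stage-`0` frame `Φ₀` with `IsRoot` [Theorems/KFrames.exists_root_frame ← KRoot, FrameStep], the certified point blow-ups
  `ShallowPort.PointBlowupCert` BY NAME (`inextCert`), and the ℕ-recursion [Theorems/KFrames.nonempty_forcedWalk_of_chain ←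
  KRoot.kframe_step ← FrameStep.frame_step, KCert.transport];
* isolation at every stage (D3) = slice A's `exists_prime_symb_of_frame` contradicted by `ForcedTower.isolated`
  [`KGener.ForcedTower.absurd_of_symb`].

All PROVED, 0 sorry; no new Literature fact; no instance / notation / axiom.
(Sources: Hauser2010 §G; CutkoskyPiltant2019 §2; ZariskiSamuel1958 Ch. III §15; Matsumura1987 §4–§9; folklore.)
-/

set_option linter.dupNamespace false

namespace Summit.ResolutionOfSingularities.ResolutionOfSingularities.Theorems.TowerDictionaryHolds

open CategoryTheory AlgebraicGeometry IsLocalRing TensorProduct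
open Literature.AlgebraicGeometry.Resolution
open Literature.AlgebraicGeometry.Resolution.PointBlowup (State)
open Summit.ResolutionOfSingularities.ResolutionOfSingularities.Theorems.ForcedTowerClasses
open Summit.ResolutionOfSingularities.ResolutionOfSingularities.Theorems.TightDefectClasses
open Summit.ResolutionOfSingularities.ResolutionOfSingularities.Theorems.FrameStep
open Summit.ResolutionOfSingularities.ResolutionOfSingularities.Theorems.ShallowPort (PointBlowupCert)

noncomputable section

/-! ## §2–§4 The dictionary: a rooted forced tower yields a rooted forced walk over `K` -/

/-- **The tower dictionary, instance-free form.**  `k` any field, `K ⊇ k` algebraically closed of characteristic `p`,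
separable over `k`, `Θ : K[Z,u₁,u₂,u₃] → L` an injective `K`-algebra map into a field (`k → K → L` a scalar tower).  A forced
point tower `T` over `k` rooted at the polynomial pure head `Z^{pᵉ} + F(u)` with datum marking `pᵉ` carries, stage by stage,
a point frame over `K`; the frames' states form a `ForcedWalk` over `K` starting at a state with `IsRoot`. -/
theorem exists_forcedWalk_of_rooted (p : ℕ) (hp : p.Prime) (e : ℕ) {k K L : Type} [Field k] [Field K] [Field L]
    [Algebra k K] [Algebra k L] [Algebra K L] [IsScalarTower k K L] [CharP K p] [PerfectField K] [IsAlgClosed K]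
    [Algebra.IsSeparable k K] [DecidableEq K] (Θ : MvPolynomial (Option (Fin 3)) K →ₐ[K] L) (hΘ : Function.Injective Θ)
    (F : Base k) (T : ForcedTower) (g : T.St 0 ⟶ Spec (.of k)) (hbase : IsBase (T.St 0) g)
    (hD : IsDatum (p ^ e) (T.D 0)) (hroot : Rooted T k (p ^ e) F) :
    ∃ s₀ : State (Fin 3) K, IsRoot (p ^ e) s₀ ∧ Nonempty (ForcedWalk (p ^ e) s₀) := by
  haveI hpF : Fact p.Prime := ⟨hp⟩
  have hq : 1 ≤ p ^ e := Nat.one_le_pow _ _ hp.pos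
  -- ### §2a the embedding `χ = Θ ∘ rho : k[u][Z] → L` and the stage-0 data
  obtain ⟨χ, hχapp⟩ : ∃ χ : Polynomial (Base k) →+* L, ∀ x, χ x = Θ (rho k K x) :=
    ⟨Θ.toRingHom.comp (rho k K), fun _ => rfl⟩
  have hχ : Function.Injective χ := fun a b hab => by
    rw [hχapp, hχapp] at hab
    exact rho_injective k K (hΘ hab)
  have hΘC : ∀ a : K, Θ (MvPolynomial.C a) = algebraMap K L a := fun a => by
    rw [← MvPolynomial.algebraMap_eq]
    exact Θ.commutes a
  have hχC : ∀ c : k, χ (Polynomial.C (MvPolynomial.C c)) = algebraMap k L c := fun c => by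
    rw [hχapp, rho_C_C, hΘC, ← IsScalarTower.algebraMap_apply]
  obtain ⟨S₀, 𝔮, h𝔮max, -, ⟨f₀, hf₀, hψf₀⟩, hden, hrange⟩ :=
    StalkThread.exists_iStage_zero hq F T hD hroot χ hχ
  have h1𝔮 : (1 : Polynomial (Base k)) ∉ 𝔮 := fun h1 => h𝔮max.ne_top ((Ideal.eq_top_iff_one _).mpr h1)
  -- ### §2b the `k`-side stages `B_i = ψ_i(𝒪_{X_i,x_i})`
  let S : ∀ i, StalkThread.IStage T L i := StalkThread.ichain T g hbase hD S₀
  have hdom : ∀ i, SubringDominates (S i).ψ.range (S (i + 1)).ψ.range := fun i =>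
    StalkThread.inextStage_dominates T g hbase hD i (S i)
  have hχmem : ∀ a, χ a ∈ (S 0).ψ.range := fun a =>
    (hrange _).mpr ⟨a, 1, h1𝔮, by rw [map_one, div_one]⟩
  have hKmem : ∀ i (c : k), algebraMap k L c ∈ (S i).ψ.range := by
    intro i c
    induction i with
    | zero => rw [← hχC]; exact hχmem _
    | succ j ih => exact (hdom j).1 ih
  let Bk : ℕ → Subalgebra k L := fun i =>
    { toSubsemiring := (S i).ψ.range.toSubsemiring
      algebraMap_mem' := hKmem i }
  have hBk : ∀ i (x : L), x ∈ Bk i ↔ x ∈ (S i).ψ.range := fun _ _ => Iff.rfl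
  have hmono : ∀ i, Bk i ≤ Bk (i + 1) := fun i x hx => (hdom i).1 hx
  -- the stalk isomorphisms `ψ_i : 𝒪_{X_i,x_i} ≃ B_i`
  let ψk : ∀ i, (T.St i).presheaf.stalk (T.pt i) →+* Bk i := fun i =>
    (S i).ψ.codRestrict (Bk i) fun x => ⟨x, rfl⟩
  have hψk : ∀ i, Function.Bijective (ψk i) := fun i =>
    ⟨fun a b hab => (S i).inj (congrArg Subtype.val hab), fun x => by
      obtain ⟨y, hy⟩ := (hBk i x).mp x.2
      exact ⟨y, Subtype.ext hy⟩⟩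
  let ek : ∀ i, (T.St i).presheaf.stalk (T.pt i) ≃+* Bk i := fun i => RingEquiv.ofBijective (ψk i) (hψk i)
  haveI hlocB : ∀ i, IsLocalRing (Bk i) := fun i => IsLocalRing.of_surjective' (ψk i) (hψk i).2
  haveI hlocS : ∀ i, IsLocalRing (S i).ψ.range := fun i => StalkThread.isLocalRing_ichain_range T g hbase hD S₀ i
  -- the inclusions `B_i ≤ B_{i+1}` are local (domination)
  have hlocincl : ∀ i, IsLocalHom (Subalgebra.inclusion (hmono i)).toRingHom := fun i => by
    constructor
    intro x hx
    obtain ⟨u, hu⟩ := hx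
    have h1 : ((u : Bk (i + 1)) : L) * ((↑u⁻¹ : Bk (i + 1)) : L) = 1 := by exact_mod_cast u.mul_inv
    have hux : ((u : Bk (i + 1)) : L) = (x : L) := by rw [hu]; rfl
    rw [hux] at h1
    have hx0 : (x : L) ≠ 0 := left_ne_zero_of_mul_eq_one h1
    have hinv : (x : L)⁻¹ ∈ (S (i + 1)).ψ.range := by
      rw [inv_eq_of_mul_eq_one_right h1]
      exact (↑u⁻¹ : Bk (i + 1)).2
    have hinv' : (x : L)⁻¹ ∈ (S i).ψ.range := (hdom i).2 _ x.2 hinv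
    exact ⟨⟨x, ⟨(x : L)⁻¹, hinv'⟩, Subtype.ext (mul_inv_cancel₀ hx0), Subtype.ext (inv_mul_cancel₀ hx0)⟩, rfl⟩
  -- ### §2c residue fields of the stages are algebraic over `k` (C4)
  have halg0 : Algebra.IsAlgebraic k (ResidueField (Bk 0)) := by
    haveI := h𝔮max
    letI alg : Algebra (Polynomial (Base k)) (Bk 0) := (χ.codRestrict (Bk 0) hχmem).toAlgebra
    haveI : IsScalarTower k (Polynomial (Base k)) (Bk 0) := IsScalarTower.of_algebraMap_eq fun c => Subtype.ext (by
      show algebraMap k L c = χ (algebraMap k (Polynomial (Base k)) c)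
      rw [Polynomial.algebraMap_apply, MvPolynomial.algebraMap_eq, hχC])
    haveI : IsLocalization.AtPrime (Bk 0) 𝔮 := by
      refine (isLocalization_iff _ _).mpr ⟨?_, ?_, ?_⟩
      · rintro ⟨s, hs⟩
        have hs' : s ∉ 𝔮 := hs
        have h0 : χ s ≠ 0 := hden s hs'
        have hinv : (χ s)⁻¹ ∈ Bk 0 := (hrange _).mpr ⟨1, s, hs', by rw [map_one, one_div]⟩
        exact ⟨⟨⟨χ s, hχmem s⟩, ⟨(χ s)⁻¹, hinv⟩, Subtype.ext (mul_inv_cancel₀ h0), Subtype.ext (inv_mul_cancel₀ h0)⟩, rfl⟩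
      · intro z
        obtain ⟨a, s, hs, hz⟩ := (hrange z).mp z.2
        refine ⟨⟨a, ⟨s, hs⟩⟩, Subtype.ext ?_⟩
        show (z : L) * χ s = χ a
        rw [hz, div_mul_cancel₀ _ (hden s hs)]
      · intro a b hab
        have hab' : χ a = χ b := congrArg Subtype.val hab
        exact ⟨1, by rw [hχ hab']⟩
    exact KResidue.isAlgebraic_residueField_of_isLocalization (k := k) (A := Polynomial (Base k)) (S := Bk 0) 𝔮
  have hroot' := hroot
  obtain ⟨ι, -⟩ := hroot'
  haveI := KResidue.locallyOfFiniteType_rootMap T ι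
  let φ : ∀ i, k →+* Bk (i + 1) := fun i =>
    (ψk (i + 1)).comp (KResidue.stalkStr T (KResidue.rootMap T ι) (i + 1) (T.pt (i + 1)))
  have hφ : ∀ i (c : k), ∃ y : Bk i, Subalgebra.inclusion (hmono i) y = φ i c := fun i c => by
    refine ⟨⟨(S i).ψ (((T.St i).presheaf.stalkCongr (.of_eq (T.pt_map i))).hom.hom
      (KResidue.stalkStr T (KResidue.rootMap T ι) i ((T.π i).base (T.pt (i + 1))) c)), ⟨_, rfl⟩⟩, Subtype.ext ?_⟩
    show (S i).ψ _ = (S (i + 1)).ψ (KResidue.stalkStr T (KResidue.rootMap T ι) (i + 1) (T.pt (i + 1)) c)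
    rw [KResidue.stalkHom_succ_apply]
    exact (StalkThread.inextStage_comp T g hbase hD i (S i) _).symm
  have hfin : ∀ i (x : ResidueField (Bk (i + 1))),
      ∃ P : Polynomial k, P ≠ 0 ∧ P.eval₂ ((residue _).comp (φ i)) x = 0 := fun i x => by
    obtain ⟨y, rfl⟩ := IsLocalRing.residue_surjective x
    obtain ⟨a, rfl⟩ := (ek (i + 1)).surjective y
    obtain ⟨P, hP0, hP⟩ := KResidue.exists_poly_residueField_pt T (KResidue.rootMap T ι) (i + 1) (residue _ a)
    refine ⟨P, hP0, ?_⟩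
    have h := congrArg (ResidueField.map ((ek (i + 1) : _ →+* Bk (i + 1)))) hP
    rw [Polynomial.hom_eval₂, map_zero] at h
    exact h
  haveI halg : ∀ i, Algebra.IsAlgebraic k (ResidueField (Bk i)) := by
    intro i
    induction i with
    | zero => exact halg0
    | succ i ih =>
      letI alg : Algebra (Bk i) (Bk (i + 1)) := (Subalgebra.inclusion (hmono i)).toRingHom.toAlgebra
      letI : SMul (Bk i) (Bk (i + 1)) := alg.toSMul
      haveI : IsScalarTower k (Bk i) (Bk (i + 1)) := IsScalarTower.of_algebraMap_eq fun c => rfl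
      haveI : IsLocalHom (algebraMap (Bk i) (Bk (i + 1))) := hlocincl i
      haveI := ih
      exact KResidue.isAlgebraic_residueField_of_factor (k := k) (R := Bk i) (R' := Bk (i + 1)) (φ i) (hφ i) (hfin i)
  -- ### §2d `μ_i : B_i ⊗_k K → L` is injective (linear disjointness)
  have hinj : Function.Injective ((Θ : MvPolynomial (Option (Fin 3)) K →+* L).comp (MvPolynomial.map (algebraMap k K))) :=
    hΘ.comp (MvPolynomial.map_injective _ (algebraMap k K).injective)
  let jk : FractionRing (MvPolynomial (Option (Fin 3)) k) →+* L := IsFractionRing.lift hinj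
  have hjk : ∀ a : MvPolynomial (Option (Fin 3)) k,
      jk (algebraMap _ (FractionRing (MvPolynomial (Option (Fin 3)) k)) a) = Θ (MvPolynomial.map (algebraMap k K) a) :=
    fun a => IsFractionRing.lift_algebraMap hinj a
  have hFk : ∀ x ∈ jk.fieldRange, ∃ a s : MvPolynomial (Option (Fin 3)) k, Θ (MvPolynomial.map (algebraMap k K) s) ≠ 0 ∧
      x = Θ (MvPolynomial.map (algebraMap k K) a) / Θ (MvPolynomial.map (algebraMap k K) s) := by
    intro x hx
    obtain ⟨z, rfl⟩ := RingHom.mem_fieldRange.mp hx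
    obtain ⟨a, s, hs, rfl⟩ := IsFractionRing.div_surjective (A := MvPolynomial (Option (Fin 3)) k) z
    refine ⟨a, s, fun h0 => nonZeroDivisors.ne_zero hs ((hinj.eq_iff' (map_zero _)).mp h0), ?_⟩
    rw [map_div₀, hjk, hjk]
  have hχjk : ∀ y, χ y ∈ jk.fieldRange := fun y =>
    RingHom.mem_fieldRange.mpr ⟨algebraMap _ _ ((MvPolynomial.optionEquivLeft k (Fin 3)).symm y), by rw [hjk, hχapp, rho_apply]⟩
  have hBFk : ∀ i, ∀ x ∈ (S i).ψ.range, x ∈ jk.fieldRange := by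
    intro i
    induction i with
    | zero =>
      intro x hx
      obtain ⟨a, s, -, rfl⟩ := (hrange x).mp hx
      exact jk.fieldRange.div_mem (hχjk a) (hχjk s)
    | succ i ih =>
      intro x hx
      obtain ⟨y, hy, z, hz, -, -, rfl⟩ := (StalkThread.inextCert T g hbase hD i (S i)).frac x hx
      have hcl : ShallowPort.chartClosure (S i).ψ.range (StalkThread.inextCert T g hbase hD i (S i)).c
          (StalkThread.inextCert T g hbase hD i (S i)).j ≤ jk.fieldRange.toSubring := by
        rw [ShallowPort.chartClosure, Subring.closure_le]
        rintro w (hw | ⟨b, -, rfl⟩)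
        · exact ih w hw
        · exact jk.fieldRange.div_mem (ih _ b.2) (ih _ ((StalkThread.inextCert T g hbase hD i (S i)).c _).2)
      exact jk.fieldRange.div_mem (hcl hy) (hcl hz)
  have hFr : ∀ i, ∀ x ∈ (Bk i).toSubring, ∃ a s : MvPolynomial (Option (Fin 3)) k,
      (Θ : MvPolynomial (Option (Fin 3)) K →+* L) (MvPolynomial.map (algebraMap k K) s) ≠ 0 ∧
      x = (Θ : MvPolynomial (Option (Fin 3)) K →+* L) (MvPolynomial.map (algebraMap k K) a) /
        (Θ : MvPolynomial (Option (Fin 3)) K →+* L) (MvPolynomial.map (algebraMap k K) s) :=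
    fun i x hx => hFk x (hBFk i x hx)
  have hμ : ∀ i, Function.Injective (KStage.mulMap K (Bk i)).toRingHom := fun i => by
    refine KThread.productMap_injective (Bk i) fun ι' s a c ha hc hsum => ?_
    have hli := LinDisjoint.linearIndependent_of_frac (k := k) (Θ : MvPolynomial (Option (Fin 3)) K →+* L) hΘ
      (Bk i).toSubring (hFr i) ha
    refine KThread.eq_zero_of_sum_mul_eq_zero_of_linearIndependent (Bk i).toSubring _ hli s c hc ?_
    simpa only [RingHom.coe_coe, hΘC] using hsum
  -- ### §2e the thread of `K`-rational points and the `K`-side stages `B̃_i`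
  obtain ⟨W, hWmax, hWB, hWrat, hWW⟩ := KStage.exists_pointThread_subalgebra (K := K) Bk hmono hlocincl
  haveI hWprime : ∀ i, (W i).IsPrime := fun i => (hWmax i).isPrime
  let Bt : ℕ → Subring L := fun i => KCarrier.carrier (KStage.mulMap K (Bk i)).toRingHom (hμ i) (W i)
  haveI hlocBt : ∀ i, IsLocalRing (Bt i) := fun i => KCarrier.isLocalRing (KStage.mulMap K (Bk i)).toRingHom (hμ i) (W i)
  have hB : ∀ i, (S i).ψ.range ≤ Bt i := fun i => KStage.toSubring_le (Bk i) (hμ i) (W i)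
  have hBt : ∀ i, Bt i ≤ Bt (i + 1) := fun i => KStage.carrier_le₂ (hmono i) (hμ i) (hμ (i + 1)) (W i) (W (i + 1)) (hWW i)
  have hmax : ∀ i, maxSet (Bt i) ⊆ maxSet (Bt (i + 1)) := fun i =>
    KStage.maxSet_subset₂ (hmono i) (hμ i) (hμ (i + 1)) (W i) (W (i + 1)) (hWW i)
  have hunit : ∀ i, unitSet (Bt i) ⊆ unitSet (Bt (i + 1)) := fun i =>
    KStage.unitSet_subset₂ (hmono i) (hμ i) (hμ (i + 1)) (W i) (W (i + 1)) (hWW i)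
  have hrat : ∀ i, ∀ w ∈ Bt i, ∃ c : K, w - algebraMap K L c ∈ maxSet (Bt i) := fun i w hw =>
    KStage.exists_sub_mem_maxSet (Bk i) (hμ i) (W i) (hWrat i) w hw
  have hgen : ∀ i, ∀ w ∈ Bt (i + 1), ∃ x ∈ Subring.closure ((Bt i : Set L) ∪ (S (i + 1)).ψ.range),
      ∃ x' ∈ Subring.closure ((Bt i : Set L) ∪ (S (i + 1)).ψ.range), x' ∈ unitSet (Bt (i + 1)) ∧ w = x / x' :=
    fun i w hw => KStage.exists_gen₂ (hμ i) (hμ (i + 1)) (W i) (W (i + 1)) w hw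
  -- the ideals `𝔪_i B_i` of the certificates and their reading in `B̃_i`
  have hMeq : ∀ i, ((maximalIdeal _).map (S i).ψ.rangeRestrict : Ideal (S i).ψ.range) = maximalIdeal (Bk i) := fun i =>
    (IsLocalRing.map_maximalIdeal_of_surjective _ (S i).ψ.rangeRestrict_surjective).trans rfl
  have hM : ∀ i (x : L), x ∈ maxSet (Bt i) ↔ ∃ hx : x ∈ Bt i,
      (⟨x, hx⟩ : Bt i) ∈ ((maximalIdeal _).map (S i).ψ.rangeRestrict : Ideal (S i).ψ.range).map (Subring.inclusion (hB i)) :=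
    fun i x => by
    rw [hMeq i]
    exact KStage.mem_maxSet_iff_mem_map (Bk i) (hμ i) (W i) (hWB i) x
  -- ### §3a the generators `f_i` of `(D i)_{x_i}` and the factorisations `f_i = w_i · c_j^{pᵉ} · f_{i+1}`
  let gen : ∀ i, {f : (T.St i).presheaf.stalk (T.pt i) // stalkIdeal (T.D i).ideal (T.pt i) = Ideal.span {f}} := fun i =>
    Nat.rec (motive := fun i => {f : (T.St i).presheaf.stalk (T.pt i) // stalkIdeal (T.D i).ideal (T.pt i) = Ideal.span {f}})
      ⟨f₀, hf₀⟩
      (fun i fi => ⟨_, (Classical.choose_spec (Classical.choose_spec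
        (StalkThread.inextStage_fact T g hbase hD i (S i) fi.1 fi.2))).2.1⟩) i
  let wst : ∀ i, (T.St (i + 1)).presheaf.stalk (T.pt (i + 1)) := fun i =>
    Classical.choose (Classical.choose_spec (StalkThread.inextStage_fact T g hbase hD i (S i) (gen i).1 (gen i).2))
  have hwst : ∀ i, IsUnit (wst i) ∧ stalkIdeal (T.D (i + 1)).ideal (T.pt (i + 1)) = Ideal.span {(gen (i + 1)).1} ∧
      (S i).ψ (gen i).1 = (S (i + 1)).ψ (wst i) *
        (((StalkThread.inextCert T g hbase hD i (S i)).c (StalkThread.inextCert T g hbase hD i (S i)).j : (S i).ψ.range) : L)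
          ^ (p ^ e) * (S (i + 1)).ψ (gen (i + 1)).1 := fun i =>
    Classical.choose_spec (Classical.choose_spec (StalkThread.inextStage_fact T g hbase hD i (S i) (gen i).1 (gen i).2))
  set FK : MvPolynomial (Fin 3) K := MvPolynomial.map (algebraMap k K) F with hFK
  let f : ℕ → L := fun i =>
    Nat.rec (motive := fun _ => L) (Θ (framePoly (p ^ e) FK)) (fun j _ => (S (j + 1)).ψ (gen (j + 1)).1) i
  have hfS : ∀ i, f i = (S i).ψ (gen i).1 := fun i => by
    cases i with
    | zero =>
      show Θ (framePoly (p ^ e) FK) = S₀.ψ f₀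
      rw [hψf₀, hχapp, rho_framePoly]
    | succ j => rfl
  let w : ℕ → L := fun i => (S (i + 1)).ψ (wst i)
  have hw : ∀ i, w i ∈ unitSet (Bt (i + 1)) := fun i =>
    KStage.coe_mem_unitSet (Bk (i + 1)) (hμ (i + 1)) (W (i + 1)) ((hwst i).1.map (ψk (i + 1)))
  have hfact : ∀ i, f i = w i *
      (((StalkThread.inextCert T g hbase hD i (S i)).c (StalkThread.inextCert T g hbase hD i (S i)).j : (S i).ψ.range) : L)
        ^ (p ^ e) * f (i + 1) := fun i => by
    rw [hfS i]
    exact (hwst i).2.2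
  have hfBk : ∀ i, f i ∈ Bk i := fun i => by rw [hfS i]; exact ⟨_, rfl⟩
  have hfBt : ∀ i, f i ∈ Bt i := fun i => hB i (hfBk i)
  have hfpow : ∀ i, ∃ h : f i ∈ Bt i, (⟨f i, h⟩ : Bt i) ∈ maximalIdeal (Bt i) ^ (p ^ e) := fun i => by
    obtain ⟨f', hf', -, hf'q⟩ := StalkThread.exists_generator_ichain T g hbase hD S₀ i
    have hmem : (gen i).1 ∈ maximalIdeal _ ^ (p ^ e) := by
      have h1 : (gen i).1 ∈ Ideal.span {f'} := ((gen i).2.symm.trans hf').le (Ideal.mem_span_singleton_self _)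
      obtain ⟨a, ha⟩ := Ideal.mem_span_singleton'.mp h1
      rw [← ha]
      exact Ideal.mul_mem_left _ a hf'q
    have h2 := (KThread.mem_pow_maximalIdeal_iff_of_ringEquiv (ek i) (p ^ e) (gen i).1).mp hmem
    have h3 := KStage.coe_mem_pow_maximalIdeal (Bk i) (hμ i) (W i) (hWB i) (p ^ e) h2
    rw [hfS i]
    exact ⟨_, h3⟩
  -- the multiplicity of every stage is `pᵉ`
  have hmult : ∀ i, (T.D i).mult = p ^ e := by
    intro i
    induction i with
    | zero => exact hD.1
    | succ i ih => rw [T.transform_eq i, MarkedIdeal.transform_mult, ih]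
  -- ### §3b the stage-0 frame with `IsRoot`
  have hK0 : ∀ c : K, algebraMap K L c ∈ Bt 0 := KStage.algebraMap_mem_carrier (Bk 0) (hμ 0) (W 0)
  have hX0 : ∀ o, Θ (MvPolynomial.X o) ∈ Bt 0 := fun o => by
    refine hB 0 ?_
    cases o with
    | none => rw [← rho_X k K, ← hχapp]; exact hχmem _
    | some j => rw [← rho_C_X k K, ← hχapp]; exact hχmem _
  have hunitχ : ∀ s, s ∉ 𝔮 → χ s ∈ unitSet (Bt 0) := fun s hs => by
    have h0 : χ s ≠ 0 := hden s hs
    have hinv : (χ s)⁻¹ ∈ Bk 0 := (hrange _).mpr ⟨1, s, hs, by rw [map_one, one_div]⟩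
    exact KStage.coe_mem_unitSet (Bk 0) (hμ 0) (W 0) (b := ⟨χ s, hχmem s⟩)
      ⟨⟨⟨χ s, hχmem s⟩, ⟨(χ s)⁻¹, hinv⟩, Subtype.ext (mul_inv_cancel₀ h0), Subtype.ext (inv_mul_cancel₀ h0)⟩, rfl⟩
  have hC : ∀ R : Subring L, (∀ c : K, algebraMap K L c ∈ R) →
      (∀ y z, Θ z ∈ unitSet (Bt 0) → Θ y / Θ z ∈ R) → (KStage.mulMap K (Bk 0)).range.toSubring ≤ R := by
    intro R hKR hR x hx
    obtain ⟨t, rfl⟩ := (AlgHom.mem_range _).mp (Subalgebra.mem_toSubring.mp hx)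
    refine KStage.range_le (Bk 0) R hKR (fun z hz => ?_) t
    obtain ⟨a, s, hs, rfl⟩ := (hrange z).mp hz
    rw [hχapp, hχapp]
    exact hR _ _ (by rw [← hχapp]; exact hunitχ s hs)
  obtain ⟨Φ₀, hΦ₀⟩ := KFrames.exists_root_frame (σ := Fin 3) p e (B' := Bt 0) Θ hΘ hK0 hX0 (hrat 0)
    (KStage.mulMap K (Bk 0)).range.toSubring hC (KStage.exists_frac (Bk 0) (hμ 0) (W 0)) FK (hfpow 0)
  -- ### §4 isolation at every stage (D3): slice A's `exists_prime_symb_of_frame` against `ForcedTower.isolated`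
  have hiso : ∀ i (Φ : KFrames.Frame (Fin 3) K (Bt i) (p ^ e) (f i)), IsolatedTop (p ^ e) Φ.s.F := by
    intro i Φ
    by_contra hni
    obtain ⟨P, hP, hPne, hsymb⟩ := exists_prime_symb_of_frame p hp e (Bk i) (hμ i) (W i) (hWmax i) (Bt := Bt i) rfl (ek i)
      (gen i).1 (x := f i) (hfS i) Φ hni
    haveI := hP
    exact KGener.ForcedTower.absurd_of_symb T i (gen i).2 P hPne (by rw [hmult i]; exact hsymb)
  -- ### §3c the walk
  obtain ⟨walk⟩ := KFrames.nonempty_forcedWalk_of_chain (σ := Fin 3) p e (fun i => (S i).ψ.range) Bt hB hBt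
    (fun i => ((maximalIdeal _).map (S i).ψ.rangeRestrict : Ideal (S i).ψ.range))
    (fun i => StalkThread.inextCert T g hbase hD i (S i)) hgen hM hmax hunit hrat f w hw hfact
    (fun i => hfpow (i + 1)) hiso Φ₀
  exact ⟨Φ₀.s, hΦ₀, ⟨walk⟩⟩

/-- **`TightDefectClasses.TowerDictionary` holds** (VERBATIM; zero extra binders): instantiate `exists_forcedWalk_of_rooted` at
`K := AlgebraicClosure k` (algebraically closed, characteristic `p`, perfect, separable over the perfect field `k`),
`L := Frac K[Z,u₁,u₂,u₃]`, `Θ` the structure map, and feed the rooted walk to the hypothesis. -/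
theorem towerDictionary_holds :
    Summit.ResolutionOfSingularities.ResolutionOfSingularities.Theorems.TightDefectClasses.TowerDictionary := by
  intro p hp e he k _ _ _ F T g hbase hD hbd hroot hwalk
  haveI : Fact p.Prime := ⟨hp⟩
  letI : DecidableEq (AlgebraicClosure k) := Classical.decEq _
  have hΘ : Function.Injective (IsScalarTower.toAlgHom (AlgebraicClosure k) (MvPolynomial (Option (Fin 3)) (AlgebraicClosure k))
      (FractionRing (MvPolynomial (Option (Fin 3)) (AlgebraicClosure k)))) :=
    IsFractionRing.injective (MvPolynomial (Option (Fin 3)) (AlgebraicClosure k)) _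
  obtain ⟨s₀, hs₀, ⟨W⟩⟩ := exists_forcedWalk_of_rooted p hp e (K := AlgebraicClosure k) _ hΘ F T g hbase hD hroot
  exact hwalk (AlgebraicClosure k) s₀ hs₀ W

end

end Summit.ResolutionOfSingularities.ResolutionOfSingularities.Theorems.TowerDictionaryHolds
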